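import Summits.BirchSwinnertonDyer.Rank1Residual.F1Sign2.EggSymbolGenusAtTwo
import Literature.NumberTheory.EllipticCurves.SerreOpenImageOrdinaryInertiaProofs
import HarnessLib

/-!
# Cell `bsd-f1-sign2` — analytic / GZ lens (seat `-an`, g7; MEMO-an v1.16 §2 AN-22): «the real place is the Kolyvagin place of level 2» —
ARCHIMEDEAN RECIPROCITY FOR THE 2-DIVISION FIELD (kernel theorems)

THEOREMS (nine, PROVED, standard axioms) + ONE plain `def NoDescAdmissibleOfNonposDisc : Prop` with its proof from the tree support
`F1Sign2.EggSymbol.OddTraceSquareResidueLaw` (AN-14G₂, `EggSymbolGenusAtTwo.lean`); nothing asserted, no conjecture tag (none needed: no candidate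
statement is left open in this file), no named fact, no `sorry`.

TYPER FILING (seat `bsd-f1-sign2-ty` g3; CANDIDATES.md rows AN-22J / AN-22T / AN-22D (+ memo rows AN-22K / P-22 / AN-23, not typed)): port VERBATIM of
the planner's `HOME/MEMO-an-data/g7/ArchReciprocityAtTwo.lean` 89e96b8313fd40ba (-an g7 2026-08-28T00:34:58Z ask D-an-17b; MEMO-an.md 50e6fd9af9bce66b
v1.16 §2 l.488 / §3 rows l.565–568; section text `MEMO-an-data/g7/AN22_section.md` 86e58d99df6e43d3; rows file `CANDIDATES-rows-an-v116.md`
e1f7f71d28952787; `lean check --json` rc 0 / 0 err / 0 warn / 0 sorry per -an and re-checked by the typer against the tree; evidence #11–#13 on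
stmt-BirchSwinnertonDyer-23715; census `MEMO-an-data/g7/an22_census_N6e4.txt` 81dd178a93fef40f, pure python 21.4 cpu-s); the only edits are this
header block and the cite-key normalisation `Gross1991` (interim stub key) ↦ `GrossLMS1991` (B. H. Gross, «Kolyvagin's work on modular elliptic
curves», LMS LN 153 (1991), the entry the locator «§3 (Kolyvagin primes)» means) in the planner's docstring, plus ONE docstring added on `noDescAdmissibleOfNonposDisc_of` (gate lint `lint.docstring`) — declarations, proofs and
namespace `…F1Sign2.ArchReciprocity` untouched. REF1-AUDIT: D-an-19 (A1–A6 / BC7 on `NoDescAdmissibleOfNonposDisc`: inhabited complement at `Δ > 0`, empty at `Δ < 0`; BC4 vs U2's sign law) was asked 2026-08-28T00:34:58Z; seat -ref1 g5 closed 00:39:28Z (final cycle, §50) before answering — PENDING for the successor. Filed ahead of it by the typer because the file is nine KERNEL theorems (axioms `propext` / `Classical.choice` / `Quot.sound`, checked) plus one `Prop` DISCHARGED in-file modulo the already-audited tree support G2 (`OddTraceSquareResidueLaw`, REF1 §31): an audit finding can only touch prose, to be folded as a text-only follow-up.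
REF2-PLACEMENT: not yet asked for this file (cc'd 00:34:58Z); the planner's own presearch (above: Kriz–Li 2019 L5.1 / C5.2 = tree U2 sign law; Mazur–Rubin 2010 Prop 3.3 + p. 14; Kramer 1981 Props 3 / 6; galaxy null ×2) stands until REF2 reads it.
PARTITION: none moved; beyond-print theorem: no (the planner: VARIANT of Kriz–Li 2019 Lemma 5.1 / Cor. 5.2 = tree
`Summit.BirchSwinnertonDyer.Uniform.U2.sign_mul_jacobiSym_conductor_eq`, new only as (i) no square / Tamagawa hypothesis, (ii) arbitrary `q ∣ d`,
(iii) the corollaries AN-22D / AN-22T).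
bears_on: `stmt-BirchSwinnertonDyer-19099` `RankOneAtTwo` → child 23715 (`S_supply`'s `0 < W.Δ` in line `egg_kolyvagin_two` is FORCED by AN-22D;
-desc's `DescAdmissible` class is empty at `Δ_W < 0`; -es NEGDISC is the same dictionary read from the Kummer side).

LANDING NOTE (-ty g14, 2026-08-29T01:5xZ; text only, statements untouched; LEAD bsd-line-fkl-p1 g18 01:29:44Z): **AN-22D `NoDescAdmissibleOfNonposDisc` IS NOW AN UNCONDITIONAL
TREE THEOREM** — `Summit.BirchSwinnertonDyer.BirchSwinnertonDyer.Theorems.RankOneAtTwoOneDoor`.noDescAdmissibleOfNonposDisc_holds : ArchReciprocity.NoDescAdmissibleOfNonposDisc` (= this file's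
`noDescAdmissibleOfNonposDisc_of` fed with AN-14G₂ `oddTraceSquareResidueLaw_holds`, now proved), in `Summits/BirchSwinnertonDyer/BirchSwinnertonDyer/Theorems/ByReductionTypeAtTwoRankOneAtTwoBigImageOddLocalOneDoorTranspositionParity.lean`
(p685553 ACCEPTED, commit 7c3ba627e036, std axioms — re-checked by the typer); same file: `doorForcesArchimedeanAtTwo_holds` (-desc §28 row R, via this file's
`Δ_pos_of_descAdmissible`) and `doorTranspositionParityAtTwo_holds` (row R⁺). Consumers: the `0 < W.Δ` binder next to `DescAdmissible W d` is redundant everywhere.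
CANDIDATES.md: AN-22D → TREE THEOREM. PARTITION: none; beyond-print theorem: no; BSD not proved; no item closed.

Planner's module docstring (verbatim, cite key normalised):

# Cell `bsd-f1-sign2` — analytic / GZ lens (seat `-an`, g7): AN-22 «the real place is the Kolyvagin place of level 2»
# — ARCHIMEDEAN RECIPROCITY FOR THE 2-DIVISION FIELD (kernel theorems; nothing asserted, no named fact, no `sorry`)

Dictionary (MEMO-an v1.16 §2 AN-22).  A Kolyvagin prime `ℓ` of level `M` is one with `Frob_ℓ ∼ τ = Frob_∞` in
`Gal(K(E[M])/ℚ)`.  At `M = 2` the class of `τ` on `E[2]` (roots of the 2-division cubic `ψ₂`, resolvent `√Δ`) is: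
`τ = 1` iff `Δ > 0` (three real roots), `τ =` a transposition iff `Δ < 0` (one real root); for a prime `q ∤ 2Δ`,
`Frob_q` is a transposition iff `(Δ/q) = −1` iff `ψ₂` has exactly one root in `𝔽_q` iff `Ẽ(𝔽_q)[2] ≅ ℤ/2`
(tree `Kramer1981.exists_natCard_torsionBy_two_eq_two_pow`: `#Ẽ(𝔽_q)[2] = 2ⁱ`, `i` even iff `Δ ∈ 𝔽_q²`).
Hilbert reciprocity for the symbol `(Δ, d)` — with `(Δ,d)_ℓ = 1` at the odd primes of `Δ` that split in `ℚ(√d)`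
and `(Δ,d)_2 = 1` for `d ≡ 1 (mod 8)` — says that the number of TRANSPOSITION PLACES among `{∞} ∪ {q ∣ d}` is even:

* §1 `jacobiSym_natAbs_eq_of_split` (AN-22J, THEOREM): `Δ ≠ 0`, `d < 0`, `d ≡ 1 (mod 8)`, `(d/ℓ) = 1` for every odd
  prime `ℓ ∣ Δ`  ⟹  `J(Δ | |d|) = +1` if `Δ > 0`, `−1` if `Δ < 0`.  Pure Jacobi-symbol algebra (Mathlib reciprocity).
* §2 `exists_prime_jacobiSym_eq_neg_one_of_neg` (AN-22T): under the same hypotheses with `Δ < 0` some prime `q ∣ d` has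
  `(Δ/q) = −1` — for `Δ = Δ_min(W)`: `Ẽ(𝔽_q)[2] ≅ ℤ/2`, `a_q` even, and the twist `W^{(d)}` has Kodaira type `I₀*` with
  `c_q(W^{(d)}) = 1 + #{roots of ψ₂ in 𝔽_q} = 2` at `q` (Tate's algorithm), so `Tam(W^{(d)})` is EVEN: at `Δ < 0` the
  «sign carrier» is a ramified prime of `K = ℚ(√d)`, never the real place.
* §3 `Δ_pos_of_descAdmissible` (AN-22D): for a globally minimal `W/ℚ`, a descent-admissible `d` (tree
  `F1Sign2.DescAdmissible`: `d < 0`, squarefree, `d ≡ 1 (8)`, every `q ∣ d` good with `a_q` odd, `(d/ℓ) = 1` at odd bad `ℓ`)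
  forces `Δ_W > 0` — PROVED from the support statement `F1Sign2.EggSymbol.OddTraceSquareResidueLaw` (AN-14G₂, `a_q` odd ⇒
  `(Δ/q) = +1`; REF1 §31: theorem on paper, PARI engine 818 477/818 477).  So the set of admissible parameters is EMPTY when
  `Δ_W < 0` (the `DescAdmissible` docstring's «exist in infinite number (Chebotarev)» is right exactly for `Δ_W > 0`), and the
  `0 < W.Δ` binder of -desc's THEOREM A / of `S_supply` in line `egg_kolyvagin_two` is forced, not chosen.

Census = cheapest falsifier (pure python in-seat, `HOME/MEMO-an-data/g7/an22_census.py`, Cremona `allcurves` `N < 60 000`,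
`d ∈ {−7, −15, …, −119}` squarefree `≡ 1 (8)` coprime to `N` with `(d/ℓ) = 1` at odd `ℓ ∣ N`): 473 999 pairs on 397 759 curves,
§1 473 999/473 999, parity of transposition primes `= [Δ < 0]` 473 999/473 999, admissible pairs 57 602 (32 159 curves) ALL with
`Δ > 0`, 0 of 274 973 `Δ < 0` pairs admissible; 21.4 cpu-s.

Nearest prior art (presearch 2026-08-28): IN TREE `Summit.BirchSwinnertonDyer.Uniform.U2.sign_mul_jacobiSym_conductor_eq`
(cell bsd-uniform, ROUTE B layer 1: `sign d · J(N | |d|) = [Δ>0 ? sign d : 1]` under `J(Δ|q) = 1` for ALL `q ∣ d` and `N|Δ|`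
a square) = Kriz–Li 2019 Lemma 5.1 / Cor. 5.2 (`ℚ(√Δ) ⊆ ℚ(E[2])`; `χ_{M*}(−N) = sgn M*` if `Δ > 0`, `+1` if `Δ < 0`).
DELTA: (i) no square / Tamagawa hypothesis (the splitting is imposed at the primes of `Δ`, not of `N`), (ii) arbitrary
`q ∣ d` (the law is the PARITY of the transposition primes, not their absence), (iii) the cell corollary AN-22D and the
`Δ < 0` reading AN-22T.  Grade claimed: VARIANT (new only as (i)–(iii)); beyond-print theorem: no.
[cite: KrizLi2019, Lemma 5.1, Cor. 5.2] [cite: Kramer1981, Prop. 3, Prop. 6] [cite: GrossLMS1991, §3 (Kolyvagin primes)]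
-/

namespace Summit.BirchSwinnertonDyer.Rank1Residual.F1Sign2.ArchReciprocity

open WeierstrassCurve Summit.BirchSwinnertonDyer.Rank1Residual.F1Sign2
  Summit.BirchSwinnertonDyer.Rank1Residual.F1Sign2.EggSymbol

set_option autoImplicit false

/-! ## §1 AN-22J: `J(Δ | |d|) = sgn Δ` -/

/-- `J(a | b) = 1` when every prime factor `q` of `b ≠ 0` has `J(a | q) = 1` (same folklore helper as
`Summit.BirchSwinnertonDyer.Uniform.U2.jacobiSym_eq_one_of_forall_prime`, restated privately to keep the import light). -/
private theorem jacobiSym_eq_one_of_forall_prime' {a : ℤ} {b : ℕ} (hb : b ≠ 0)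
    (h : ∀ q : ℕ, q.Prime → q ∣ b → jacobiSym a q = 1) : jacobiSym a b = 1 := by
  rw [← Nat.prod_primeFactorsList hb, jacobiSym.list_prod_right
    (fun n hn => (Nat.prime_of_mem_primeFactorsList hn).ne_zero)]
  refine List.prod_eq_one (fun x hx => ?_)
  obtain ⟨q, hq, rfl⟩ := List.mem_map.1 hx
  exact h q (Nat.prime_of_mem_primeFactorsList hq) (Nat.dvd_of_mem_primeFactorsList hq)

/-- **AN-22J (archimedean reciprocity for the resolvent).** For `Δ ≠ 0`, `d < 0` with `d ≡ 1 (mod 8)` such that every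
odd prime `ℓ ∣ Δ` splits in `ℚ(√d)` (`(d/ℓ) = 1`): `J(Δ | |d|) = sgn Δ`.  Proof: write `|Δ| = 2ᵏ·m`, `m` odd;
`(2 | |d|) = χ₈(|d|) = 1` (`|d| ≡ 7 (8)`); `(m | |d|) = ± (|d| | m)` by reciprocity (`|d| ≡ 3 (4)`), and
`(|d| | m) = (−1 | m)·(d | m) = χ₄(m)` because `(d | m) = ∏_{ℓ ∣ m} (d/ℓ)^{e_ℓ} = 1`; the signs cancel in both
cases `m ≡ 1, 3 (4)`; finally `(−1 | |d|) = χ₄(|d|) = −1`. [folklore; cf. KrizLi2019 Lemma 5.1] -/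
theorem jacobiSym_natAbs_eq_of_split {Δ d : ℤ} (hΔ : Δ ≠ 0) (hd : d < 0) (hd8 : d % 8 = 1)
    (hsplit : ∀ ℓ : ℕ, ℓ.Prime → ℓ ≠ 2 → (ℓ : ℤ) ∣ Δ → jacobiSym d ℓ = 1) :
    jacobiSym Δ d.natAbs = if 0 < Δ then 1 else -1 := by
  -- the odd modulus `D = |d|`
  set D : ℕ := d.natAbs with hDdef
  have hDd : (D : ℤ) = -d := by omega
  have hD8 : D % 8 = 7 := by omega
  have hD4 : D % 4 = 3 := by omega
  have hDodd : Odd D := Nat.odd_iff.mpr (by omega)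
  -- `|Δ| = 2^k * m`, `m` odd
  obtain ⟨k, m, hm, hkm⟩ := Nat.exists_eq_two_pow_mul_odd (Int.natAbs_ne_zero.mpr hΔ)
  have hm0 : m ≠ 0 := by rintro rfl; exact (Nat.not_odd_zero hm).elim
  have hm2 : m % 2 = 1 := Nat.odd_iff.mp hm
  -- every prime factor of `m` is an odd prime factor of `Δ`, so `(d | m) = 1`
  have hJdm : jacobiSym d m = 1 := by
    refine jacobiSym_eq_one_of_forall_prime' hm0 (fun ℓ hℓ hℓm => hsplit ℓ hℓ ?_ ?_)
    · rintro rfl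
      have : 2 ∣ m := hℓm
      omega
    · have h1 : (ℓ : ℤ) ∣ (Δ.natAbs : ℤ) := by
        rw [hkm]; push_cast; exact Dvd.dvd.mul_left (Int.natCast_dvd_natCast.mpr hℓm) _
      exact Int.dvd_natAbs.mp h1
  -- `(|d| | m) = χ₄ m`
  have hJDm : jacobiSym (D : ℤ) m = ZMod.χ₄ m := by
    rw [hDd, jacobiSym.neg _ hm, hJdm, mul_one]
  -- `(m | |d|) = 1` by reciprocity
  have hJmD : jacobiSym (m : ℤ) D = 1 := by
    rcases Nat.odd_mod_four_iff.mp hm2 with h1 | h3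
    · rw [jacobiSym.quadratic_reciprocity_one_mod_four h1 hDodd, hJDm, ZMod.χ₄_nat_one_mod_four h1]
    · rw [jacobiSym.quadratic_reciprocity_three_mod_four h3 hD4, hJDm, ZMod.χ₄_nat_three_mod_four h3]
      norm_num
  -- `(2 | |d|) = 1`
  have hJ2D : jacobiSym 2 D = 1 := by
    rw [jacobiSym.at_two hDodd, ZMod.χ₈_nat_eq_if_mod_eight]
    rw [if_neg (by omega), if_pos (Or.inr hD8)]
  -- `(2^k m | |d|) = 1`
  have hJabs : jacobiSym ((2 : ℤ) ^ k * (m : ℤ)) D = 1 := by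
    rw [jacobiSym.mul_left, jacobiSym.pow_left, hJ2D, one_pow, one_mul, hJmD]
  have habs : (Δ.natAbs : ℤ) = (2 : ℤ) ^ k * (m : ℤ) := by exact_mod_cast hkm
  by_cases hpos : 0 < Δ
  · rw [if_pos hpos]
    have hΔeq : Δ = (2 : ℤ) ^ k * (m : ℤ) := by rw [← habs]; omega
    rw [hΔeq]
    exact hJabs
  · rw [if_neg hpos]
    have hΔeq : Δ = -1 * ((2 : ℤ) ^ k * (m : ℤ)) := by rw [← habs]; omega
    rw [hΔeq, jacobiSym.mul_left, hJabs, mul_one, jacobiSym.at_neg_one hDodd, ZMod.χ₄_nat_three_mod_four hD4]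

/-! ## §2 AN-22T: at `Δ < 0` a transposition prime divides `d` -/

/-- **AN-22T.** Under the hypotheses of AN-22J with `Δ < 0`, some prime `q ∣ d` has `J(Δ | q) = −1`
(for `Δ = Δ_min(W)` and `q` of good reduction: `Frob_q` is a transposition on `W[2]`, `Ẽ(𝔽_q)[2] ≅ ℤ/2`, `a_q(W)` is even,
and `c_q(W^{(d)}) = 2`). [folklore; Mathlib `jacobiSym.eq_neg_one_at_prime_divisor_of_eq_neg_one`] -/
theorem exists_prime_jacobiSym_eq_neg_one_of_neg {Δ d : ℤ} (hΔ : Δ < 0) (hd : d < 0) (hd8 : d % 8 = 1)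
    (hsplit : ∀ ℓ : ℕ, ℓ.Prime → ℓ ≠ 2 → (ℓ : ℤ) ∣ Δ → jacobiSym d ℓ = 1) :
    ∃ q : ℕ, q.Prime ∧ (q : ℤ) ∣ d ∧ jacobiSym Δ q = -1 := by
  have h := jacobiSym_natAbs_eq_of_split hΔ.ne hd hd8 hsplit
  rw [if_neg (not_lt.mpr hΔ.le)] at h
  obtain ⟨q, hq, hqd, hJ⟩ := jacobiSym.eq_neg_one_at_prime_divisor_of_eq_neg_one h
  exact ⟨q, hq, Int.dvd_natAbs.mp (Int.natCast_dvd_natCast.mpr hqd), hJ⟩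

/-- Conversely at `Δ > 0`: if every prime `q ∣ d` except possibly one, `q₀`, has `J(Δ | q) = 1`, then so does `q₀`
(the number of transposition primes is even — here: not exactly one). [folklore] -/
theorem jacobiSym_eq_one_of_pos_of_others {Δ d : ℤ} (hΔ : 0 < Δ) (hd : d < 0) (hd8 : d % 8 = 1)
    (hsplit : ∀ ℓ : ℕ, ℓ.Prime → ℓ ≠ 2 → (ℓ : ℤ) ∣ Δ → jacobiSym d ℓ = 1)
    (hsqf : Squarefree d) {q₀ : ℕ} (hq₀ : q₀.Prime) (hq₀d : (q₀ : ℤ) ∣ d)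
    (hothers : ∀ q : ℕ, q.Prime → (q : ℤ) ∣ d → q ≠ q₀ → jacobiSym Δ q = 1) :
    jacobiSym Δ q₀ = 1 := by
  have h := jacobiSym_natAbs_eq_of_split hΔ.ne' hd hd8 hsplit
  rw [if_pos hΔ] at h
  -- split `|d| = q₀ * e` with `q₀ ∤ e`
  obtain ⟨e, he⟩ : q₀ ∣ d.natAbs := Int.natAbs_dvd_natAbs.mpr hq₀d |>.trans (by simp)
  have he0 : e ≠ 0 := by rintro rfl; simp at he; omega
  have hq0 : q₀ ≠ 0 := hq₀.ne_zero
  have hJe : jacobiSym Δ e = 1 := by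
    refine jacobiSym_eq_one_of_forall_prime' he0 (fun q hq hqe => hothers q hq ?_ ?_)
    · have h1 : q ∣ d.natAbs := by rw [he]; exact Dvd.dvd.mul_left hqe q₀
      exact Int.dvd_natAbs.mp (Int.natCast_dvd_natCast.mpr h1)
    · intro hqq
      rw [hqq] at hqe
      -- `q₀² ∣ d` contradicts squarefreeness
      have hsq : (q₀ : ℤ) * q₀ ∣ d := by
        have h2 : q₀ * q₀ ∣ d.natAbs := by rw [he]; exact Nat.mul_dvd_mul_left q₀ hqe
        exact Int.dvd_natAbs.mp (by exact_mod_cast h2)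
      have hu := hsqf (q₀ : ℤ) hsq
      rw [Int.isUnit_iff] at hu
      rcases hu with hu | hu
      · exact hq₀.one_lt.ne' (by exact_mod_cast hu)
      · omega
  rw [he, jacobiSym.mul_right' Δ hq0 he0, hJe, mul_one] at h
  exact h

/-! ## §3 AN-22D: descent-admissible parameters force `Δ_W > 0` -/

/-- The numerator of `W.Δ` is the minimal discriminant (`(Δ_min : ℚ) = W.Δ`, tree `cast_minimalDiscriminantInt`). -/
theorem num_Δ_eq_minimalDiscriminantInt (W : WeierstrassCurve ℚ) [W.IsGloballyMinimal] :
    W.Δ.num = minimalDiscriminantInt W := by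
  rw [← cast_minimalDiscriminantInt W, Rat.num_intCast]

/-- **AN-22D.** A descent-admissible `d` for a globally minimal elliptic `W/ℚ` exists only if `Δ_W > 0` — from AN-22J and
the resolvent law `OddTraceSquareResidueLaw` (AN-14G₂: `a_q` odd at a good odd `q` ⇒ `(Δ/q) = +1`). -/
theorem Δ_pos_of_descAdmissible (hG2 : OddTraceSquareResidueLaw) (W : WeierstrassCurve ℚ) [W.IsElliptic]
    [W.IsGloballyMinimal] {d : ℤ} (hadm : DescAdmissible W d) : 0 < W.Δ := by
  obtain ⟨hd, _hsqf, hd8, hgood, hbad⟩ := hadm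
  have hΔ0 : W.Δ.num ≠ 0 := by
    rw [num_Δ_eq_minimalDiscriminantInt]; exact minimalDiscriminantInt_ne_zero W
  -- splitting at every odd prime of `Δ_min`: such a prime is bad
  have hsplit : ∀ ℓ : ℕ, ℓ.Prime → ℓ ≠ 2 → (ℓ : ℤ) ∣ W.Δ.num → jacobiSym d ℓ = 1 := by
    intro ℓ hℓ hℓ2 hℓΔ
    refine hbad ℓ hℓ hℓ2 (fun hF hgoodℓ => ?_)
    haveI := hF
    have := not_dvd_minimalDiscriminantInt_of_hasGoodReductionAtPrime' W ℓ hgoodℓ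
    rw [← num_Δ_eq_minimalDiscriminantInt] at this
    exact this hℓΔ
  have hJ := jacobiSym_natAbs_eq_of_split hΔ0 hd hd8 hsplit
  -- and `J(Δ | |d|) = 1` prime by prime from `a_q` odd
  have hJ1 : jacobiSym W.Δ.num d.natAbs = 1 := by
    refine jacobiSym_eq_one_of_forall_prime' (by omega) (fun q hq hqd => ?_)
    have hqd' : (q : ℤ) ∣ d := Int.dvd_natAbs.mp (Int.natCast_dvd_natCast.mpr hqd)
    have hq2 : q ≠ 2 := by rintro rfl; obtain ⟨c, hc⟩ := hqd'; omega
    obtain ⟨hgq, hodd⟩ := hgood q hq hqd'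
    exact hG2 W q hq hq2 hgq hodd
  rw [hJ1] at hJ
  by_contra hle
  have : ¬ 0 < W.Δ.num := by rw [Rat.num_pos]; exact hle
  rw [if_neg this] at hJ
  norm_num at hJ

/-- **AN-22D, contrapositive / `Prop` form** (the typed candidate of MEMO-an v1.16: «no descent-admissible twist at `Δ < 0`»),
for the CANDIDATES row; proved above from `OddTraceSquareResidueLaw`. -/
def NoDescAdmissibleOfNonposDisc : Prop :=
  ∀ (W : WeierstrassCurve ℚ) [W.IsElliptic] [W.IsGloballyMinimal] (d : ℤ), W.Δ < 0 → ¬ DescAdmissible W d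

/-- AN-22D discharged modulo G2: `OddTraceSquareResidueLaw ⇒ NoDescAdmissibleOfNonposDisc` (pointwise `Δ_pos_of_descAdmissible`).
(Docstring added by the typer — gate lint `lint.docstring`; statement and proof are the planner's, verbatim.) -/
theorem noDescAdmissibleOfNonposDisc_of (hG2 : OddTraceSquareResidueLaw) : NoDescAdmissibleOfNonposDisc := by
  intro W _ _ d hΔ hadm
  exact absurd (Δ_pos_of_descAdmissible hG2 W hadm) (not_lt.mpr hΔ.le)

/-- **AN-22T for curves** («the sign carrier at `Δ < 0` is a ramified prime»): `Δ_W < 0`, `d < 0`, `d ≡ 1 (8)` and every odd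
bad prime split in `ℚ(√d)` ⇒ some prime `q ∣ d` has `(Δ_W/q) = −1`; if `q` is a good prime then `Frob_q` is a transposition on
`W[2]` (`a_q(W)` even by `OddTraceSquareResidueLaw`, `Ẽ(𝔽_q)[2] ≅ ℤ/2`, `c_q(W^{(d)}) = 2`). Unconditional. -/
theorem exists_transpositionPrime_of_Δ_neg (W : WeierstrassCurve ℚ) [W.IsElliptic] [W.IsGloballyMinimal]
    (hΔ : W.Δ < 0) {d : ℤ} (hd : d < 0) (hd8 : d % 8 = 1)
    (hbad : ∀ ℓ : ℕ, ℓ.Prime → ℓ ≠ 2 → (∀ _h : Fact ℓ.Prime, ¬ W.HasGoodReductionAtPrime ℓ) → jacobiSym d ℓ = 1) :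
    ∃ q : ℕ, q.Prime ∧ (q : ℤ) ∣ d ∧ jacobiSym W.Δ.num q = -1 := by
  have hΔ' : W.Δ.num < 0 := Rat.num_neg.mpr hΔ
  refine exists_prime_jacobiSym_eq_neg_one_of_neg hΔ' hd hd8 (fun ℓ hℓ hℓ2 hℓΔ => hbad ℓ hℓ hℓ2 (fun hF hgoodℓ => ?_))
  haveI := hF
  have := not_dvd_minimalDiscriminantInt_of_hasGoodReductionAtPrime' W ℓ hgoodℓ
  rw [← num_Δ_eq_minimalDiscriminantInt] at this
  exact this hℓΔ

/-- … and then `a_q(W)` is even at that prime whenever it is a prime of good reduction (contrapositive of AN-14G₂). -/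
theorem exists_even_frobeniusTrace_of_Δ_neg (hG2 : OddTraceSquareResidueLaw) (W : WeierstrassCurve ℚ) [W.IsElliptic]
    [W.IsGloballyMinimal] (hΔ : W.Δ < 0) {d : ℤ} (hd : d < 0) (hd8 : d % 8 = 1)
    (hbad : ∀ ℓ : ℕ, ℓ.Prime → ℓ ≠ 2 → (∀ _h : Fact ℓ.Prime, ¬ W.HasGoodReductionAtPrime ℓ) → jacobiSym d ℓ = 1)
    (hgood : ∀ q : ℕ, q.Prime → (q : ℤ) ∣ d → ∀ _h : Fact q.Prime, W.HasGoodReductionAtPrime q) :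
    ∃ q : ℕ, q.Prime ∧ (q : ℤ) ∣ d ∧ Even (W.frobeniusTrace q) := by
  obtain ⟨q, hq, hqd, hJ⟩ := exists_transpositionPrime_of_Δ_neg W hΔ hd hd8 hbad
  refine ⟨q, hq, hqd, ?_⟩
  have hq2 : q ≠ 2 := by rintro rfl; obtain ⟨c, hc⟩ := hqd; omega
  by_contra hodd
  rw [Int.not_even_iff_odd] at hodd
  have := hG2 W q hq hq2 (hgood q hq hqd) hodd
  rw [this] at hJ
  norm_num at hJ

end Summit.BirchSwinnertonDyer.Rank1Residual.F1Sign2.ArchReciprocity
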